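import Literature.AlgebraicGeometry.Resolution.ArithmeticalThreefoldsFiniteDenominators
import Literature.AlgebraicGeometry.Resolution.LocalBlowup
import HarnessLib

/-!
# Cossart–Piltant 2019, Prop. 4.8: models with `K`-finite denominators lie in `T⁻¹Â`

Topic: `Literature/AlgebraicGeometry/Resolution` (proofs only; no new notions, no new named
facts). Continuation of `ArithmeticalThreefoldsFiniteDenominators.lean`. The run of Lemma 4.7
along `v̂` (`exists_adjoin_isRegularLocalRing_of_principalizedFrame`,
`ArithmeticalThreefoldsDescentHeadRun.lean`) asks that the base local ring `A_e` of the descent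
(the local ring of the model at the centre of `v̂`) be contained in a subring `C` of
`K`-finite-denominator fractions and that the tracked element `F` be invertible in `C`. This
file supplies both from the shape of the model required by the geometric head ((H1) of the
census: generators with `K`-finite denominators over `Â`):

* `inv_mem_of_valuation_le_of_finite_denominators` — a `K`-finite element of such a `C` is
  invertible in `C`;
* `locAtCentre_adjoin_le_of_finite_denominators` — the local ring at the centre of `O'` of a
  model `Â[t₀]` whose generators have `K`-finite denominators lies in `C` (numerators lie in
  `Â[t₀] ⊆ C`; a denominator of value `0` is `K`-finite, hence invertible in `C`).

## Sources

* V. Cossart, O. Piltant, J. Algebra 529 (2019) 268–535 = arXiv:1412.0868, proof of Prop. 4.8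
  with Lemma 4.7 (arXiv v1: Prop. 4.6, pp. 52–53). [CossartPiltant2019]
-/

noncomputable section

namespace Literature.AlgebraicGeometry.Resolution

universe u v w

open IsLocalRing

variable {A : Type u} [CommRing A] [IsLocalRing A]
  {K : Type v} [Field K]

/-- **`K`-finite elements of `T⁻¹Â` are units of `T⁻¹Â`.** Let `C ⊆ K̂₁` consist of fractions
`x/e` (`x, e ∈ Â`, `e` `K`-finite) and contain the inverses of the `K`-finite elements of `Â`
(`exists_subring_finite_denominators`). If `y ∈ C` is itself `K`-finite (`v̂(ι b) ≤ v̂(y)`,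
`b ∈ K^×`; `O' ⊇ Â`), then `y⁻¹ ∈ C`: `y = x/e` with `v̂(x) = v̂(y) v̂(e)` bounded below by a
`K`-value, so `x` is `K`-finite and `y⁻¹ = e · x⁻¹`. (In Cossart–Piltant: `h⁻¹`, and the
inverses of the units of `𝒪_{Ŷ,ŷ}`, lie in `T⁻¹Â`.)
[cite: CossartPiltant2019, proof of Prop. 4.8 with Lemma 4.7 (arXiv v1: Prop. 4.6, pp. 52–53)] -/
theorem inv_mem_of_valuation_le_of_finite_denominators
    {K₁ : Type w} [Field K₁] [Algebra (AdicCompletion (maximalIdeal A) A) K₁]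
    (ι : K →+* K₁) (O' : ValuationSubring K₁) (C : Subring K₁)
    (hC : ∀ y ∈ C, ∃ x e : AdicCompletion (maximalIdeal A) A,
      (∃ b : K, b ≠ 0 ∧ O'.valuation (ι b) ≤ O'.valuation (algebraMap _ K₁ e)) ∧
        y * algebraMap _ K₁ e = algebraMap _ K₁ x)
    (hCA : ∀ x : AdicCompletion (maximalIdeal A) A, algebraMap _ K₁ x ∈ C)
    (hCinv : ∀ e : AdicCompletion (maximalIdeal A) A,
      (∃ b : K, b ≠ 0 ∧ O'.valuation (ι b) ≤ O'.valuation (algebraMap _ K₁ e)) →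
        (algebraMap _ K₁ e)⁻¹ ∈ C)
    {y : K₁} (hy : y ∈ C) {b : K} (hb : b ≠ 0) (hyb : O'.valuation (ι b) ≤ O'.valuation y) :
    y⁻¹ ∈ C := by
  have hpos : ∀ b : K, b ≠ 0 → 0 < O'.valuation (ι b) := fun b hb =>
    zero_lt_iff.mpr ((Valuation.ne_zero_iff _).mpr ((map_ne_zero ι).mpr hb))
  obtain ⟨x, e, ⟨b', hb', hbe⟩, hye⟩ := hC y hy
  have he0 : algebraMap (AdicCompletion (maximalIdeal A) A) K₁ e ≠ 0 := fun h0 => by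
    rw [h0, map_zero] at hbe; exact not_lt.mpr hbe (hpos b' hb')
  -- `x = y e` is `K`-finite
  have hx : ∃ b'' : K, b'' ≠ 0 ∧ O'.valuation (ι b'') ≤ O'.valuation (algebraMap _ K₁ x) :=
    ⟨b * b', mul_ne_zero hb hb', by
      rw [← hye, map_mul, map_mul, map_mul]
      exact mul_le_mul' hyb hbe⟩
  have hx0 : algebraMap (AdicCompletion (maximalIdeal A) A) K₁ x ≠ 0 := fun h0 => by
    obtain ⟨b'', hb'', h⟩ := hx
    rw [h0, map_zero] at h; exact not_lt.mpr h (hpos b'' hb'')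
  have hy0 : y ≠ 0 := fun h0 => by rw [h0, zero_mul] at hye; exact hx0 hye.symm
  -- `y⁻¹ = e / x`
  have hinv : y⁻¹ = algebraMap _ K₁ e * (algebraMap _ K₁ x)⁻¹ := by
    rw [← hye, mul_inv, ← mul_assoc, mul_comm (algebraMap _ K₁ e), mul_assoc,
      mul_inv_cancel₀ he0, mul_one]
  rw [hinv]
  exact C.mul_mem (hCA e) (hCinv x hx)

/-- **Models with `K`-finite denominators lie in `T⁻¹Â`.** Let `C ⊆ K̂₁` be as in
`exists_subring_finite_denominators` (fractions with `K`-finite denominators, containing `Â` and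
the inverses of the `K`-finite elements), `O' ⊇ Â` a valuation ring of `K̂₁`, and `t₀ ⊆ K̂₁` a set
of generators each of which has a `K`-finite denominator in `Â` (`a_z · z ∈ Â`, `a_z` `K`-finite —
the shape of the local uniformization of `v̂` required by the geometric head). Then the local ring
`locAtCentre (Â[t₀]) O'` of the model at the centre of `O'` lies in `C`: numerators lie in
`Â[t₀] ⊆ C`, and a denominator `Q ∈ Â[t₀]` of value `0` is a `K`-finite element of `C`, hence
invertible in `C`. (So the archimedean comparabilities and rational-rank relations along `v̂` hold
on the local rings of such models.)
[cite: CossartPiltant2019, proof of Prop. 4.8 with Lemma 4.7 (arXiv v1: Prop. 4.6, pp. 52–53)] -/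
theorem locAtCentre_adjoin_le_of_finite_denominators
    {K₁ : Type w} [Field K₁] [Algebra (AdicCompletion (maximalIdeal A) A) K₁]
    (ι : K →+* K₁) (O' : ValuationSubring K₁) (C : Subring K₁)
    (hC : ∀ y ∈ C, ∃ x e : AdicCompletion (maximalIdeal A) A,
      (∃ b : K, b ≠ 0 ∧ O'.valuation (ι b) ≤ O'.valuation (algebraMap _ K₁ e)) ∧
        y * algebraMap _ K₁ e = algebraMap _ K₁ x)
    (hCA : ∀ x : AdicCompletion (maximalIdeal A) A, algebraMap _ K₁ x ∈ C)
    (hCinv : ∀ e : AdicCompletion (maximalIdeal A) A,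
      (∃ b : K, b ≠ 0 ∧ O'.valuation (ι b) ≤ O'.valuation (algebraMap _ K₁ e)) →
        (algebraMap _ K₁ e)⁻¹ ∈ C)
    (t₀ : Set K₁)
    (hden : ∀ z ∈ t₀, ∃ a x : AdicCompletion (maximalIdeal A) A,
      (∃ b : K, b ≠ 0 ∧ O'.valuation (ι b) ≤ O'.valuation (algebraMap _ K₁ a)) ∧
        algebraMap _ K₁ a * z = algebraMap _ K₁ x) :
    locAtCentre (Algebra.adjoin (AdicCompletion (maximalIdeal A) A) t₀).toSubring O' ≤ C := by
  have hpos : ∀ b : K, b ≠ 0 → 0 < O'.valuation (ι b) := fun b hb =>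
    zero_lt_iff.mpr ((Valuation.ne_zero_iff _).mpr ((map_ne_zero ι).mpr hb))
  -- `Â[t₀] ⊆ C`
  have hTC : (Algebra.adjoin (AdicCompletion (maximalIdeal A) A) t₀).toSubring ≤ C := by
    let C' : Subalgebra (AdicCompletion (maximalIdeal A) A) K₁ :=
      { C with algebraMap_mem' := fun x => hCA x }
    have h : Algebra.adjoin (AdicCompletion (maximalIdeal A) A) t₀ ≤ C' := by
      rw [Algebra.adjoin_le_iff]
      intro z hz
      obtain ⟨a, x, ha, haz⟩ := hden z hz
      have ha0 : algebraMap (AdicCompletion (maximalIdeal A) A) K₁ a ≠ 0 := fun h0 => by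
        obtain ⟨b, hb, h⟩ := ha
        rw [h0, map_zero] at h; exact not_lt.mpr h (hpos b hb)
      have : z = (algebraMap _ K₁ a)⁻¹ * algebraMap _ K₁ x := by
        rw [← haz, ← mul_assoc, inv_mul_cancel₀ ha0, one_mul]
      change z ∈ C
      rw [this]
      exact C.mul_mem (hCinv a ha) (hCA x)
    intro y hy
    exact h hy
  -- fractions with a denominator of value `0`
  rintro _ ⟨P, hP, Q, hQ, hvQ, rfl⟩
  have hQC : Q ∈ C := hTC hQ
  have hQinv : Q⁻¹ ∈ C :=
    inv_mem_of_valuation_le_of_finite_denominators ι O' C hC hCA hCinv hQC one_ne_zero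
      (by rw [map_one, map_one, hvQ])
  rw [div_eq_mul_inv]
  exact C.mul_mem (hTC hP) hQinv

end Literature.AlgebraicGeometry.Resolution

end
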